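import Literature.MathematicalPhysics.QuantumLattice.FockRelabel
import HarnessLib

/-!
# The space-group selection rule for the `d_{x²-y²}` pair field on the square torus

Topic `Literature/MathematicalPhysics/QuantumLattice` (vocabulary of `FockRelabel`: the Fock-space unitaries
`fockRelabel π`, the torus translations `fockTranslate v`, the point group `fockD4 γ`, and `PairCorrelations`:
`pairField`, `dWaveFormFactor`, `b1gChar`).

Content (all PROVED, finite-dimensional linear algebra; written for the crux `JosephsonMirror.JmPairBridge` of summit
`HubbardSuperconductivity`, whose kill criterion is a "selection-rule mismatch" between adjacent ground floors, and for the
Schur-type lines that manage the symmetry of ground floors):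

* `dotProduct_mulVec_eq_zero_of_twisted_eigen` — the abstract SELECTION RULE: if `V` preserves inner products, twists `Δ`
  by a scalar (`V Δ = c • Δ V`) and `φ`, `χ` are `V`-eigenvectors with eigenvalues `lam`, `mu`, `star mu * c * lam ≠ 1`,
  then `⟨χ, Δ φ⟩ = 0` (Wigner's selection rule for a one-dimensional representation);
* `star_mul_self_eq_one_of_eigen` — eigenvalues of inner-product preserving maps on unit vectors are unimodular;
* `spaceGroup_mul_pairField_dWave` — for the space-group element `g = (γ, v)` realised by `U_g = fockD4 γ * fockTranslate v`:
  `U_g Δ_d = χ_{B₁g}(γ) • Δ_d U_g` (translation invariance + `B₁g` covariance of `Δ_d`);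
* `star_spaceGroup_mulVec_dotProduct`, `IsGroundStateInSector.spaceGroup_mulVec` — `U_g` is isometric and transports sector
  ground states of `hubbardTorus 2 L t U`;
* `pairField_dWave_matrixElement_eq_zero` — THE SELECTION RULE FOR `Δ_d`: if `U_g φ = lam φ`, `U_g χ = mu χ`, `‖χ‖ = 1`
  and `mu ≠ χ_{B₁g}(γ) lam`, then `⟨χ, Δ_d φ⟩ = 0` (momentum mismatch for `γ = 1`, `C₄`-character mismatch for `v = 0`).

Not here: any statement about WHICH quantum numbers Hubbard ground floors have (open for the doped repulsive model).

Sources: D. J. Scalapino, Phys. Rep. 250 (1995) 329, §2 eqs. (2.2)–(2.3) (`Δ_d`, `C₄ᵥ`, `B₁g`); E. P. Wigner, *Group Theory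
and its Application to the Quantum Mechanics of Atomic Spectra* (1959), ch. 12 (selection rules) — used only as folklore;
O. Bratteli, D. W. Robinson, *Operator Algebras and Quantum Statistical Mechanics II*, §5.2.2 (implementing unitaries).
-/

noncomputable section

namespace Literature.MathematicalPhysics.QuantumLattice

open Matrix HubbardWave0 Literature.Probability.LatticeModels

/-! ### Abstract selection rule -/

/-- **Selection rule (abstract; Wigner).** If `V` preserves the Hermitian inner product, twists `Δ` by the scalar `c`
(`V Δ = c • Δ V`), and `φ`, `χ` are `V`-eigenvectors with eigenvalues `lam`, `mu` such that `star mu * c * lam ≠ 1`,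
then the matrix element `⟨χ, Δ φ⟩ = star χ ⬝ᵥ Δ φ` vanishes. [folklore] -/
theorem dotProduct_mulVec_eq_zero_of_twisted_eigen {n : Type*} [Fintype n]
    (V Δ : Matrix n n ℂ) (c lam mu : ℂ) (φ χ : n → ℂ)
    (hV : ∀ x y : n → ℂ, star (V *ᵥ x) ⬝ᵥ (V *ᵥ y) = star x ⬝ᵥ y)
    (hΔ : V * Δ = c • (Δ * V)) (hφ : V *ᵥ φ = lam • φ) (hχ : V *ᵥ χ = mu • χ)
    (hne : star mu * c * lam ≠ 1) :
    star χ ⬝ᵥ (Δ *ᵥ φ) = 0 := by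
  have h1 : V *ᵥ (Δ *ᵥ φ) = (c * lam) • (Δ *ᵥ φ) := by
    rw [mulVec_mulVec, hΔ, smul_mulVec, ← mulVec_mulVec, hφ, mulVec_smul, smul_smul]
  have h2 := hV χ (Δ *ᵥ φ)
  rw [h1, hχ, star_smul, smul_dotProduct, dotProduct_smul, smul_eq_mul, smul_eq_mul, ← mul_assoc] at h2
  -- `(star mu * c * lam) * z = z` with `star mu * c * lam ≠ 1` forces `z = 0`
  have h3 : (star mu * c * lam - 1) * (star χ ⬝ᵥ (Δ *ᵥ φ)) = 0 := by
    rw [sub_mul, one_mul, sub_eq_zero]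
    simpa [mul_assoc] using h2
  rcases mul_eq_zero.mp h3 with h | h
  · exact absurd (sub_eq_zero.mp h) hne
  · exact h

/-- The eigenvalue of a unit eigenvector of an inner-product preserving map is unimodular: `star mu * mu = 1`. [folklore] -/
theorem star_mul_self_eq_one_of_eigen {n : Type*} [Fintype n]
    (V : Matrix n n ℂ) (mu : ℂ) (χ : n → ℂ)
    (hV : ∀ x y : n → ℂ, star (V *ᵥ x) ⬝ᵥ (V *ᵥ y) = star x ⬝ᵥ y)
    (hχ : V *ᵥ χ = mu • χ) (hχ1 : star χ ⬝ᵥ χ = 1) :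
    star mu * mu = 1 := by
  have h := hV χ χ
  rw [hχ, star_smul, smul_dotProduct, dotProduct_smul, smul_eq_mul, smul_eq_mul, hχ1, mul_one] at h
  exact h

/-! ### The space group of the square torus and the `d`-wave pair field -/

section Torus

variable {L : ℕ} [NeZero L]

/-- **`U_g Δ_d = χ_{B₁g}(γ) • Δ_d U_g`** for the space-group unitary `U_g = U_γ U_v = fockD4 γ * fockTranslate v` of the
square torus: the `d_{x²-y²}` pair field is translation invariant (`relabel_translate_pairField`) and transforms in the
`B₁g` representation of `D₄` (`relabel_d4Perm_pairField_dWave`). [cite: Scalapino1995, §2 eq. (2.3)] -/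
theorem spaceGroup_mul_pairField_dWave (γ : DihedralGroup 4) (v : TorusSite 2 L) :
    ((fockD4 (L := L) γ).val * (fockTranslate v).val) * pairField dWaveFormFactor L =
      b1gChar γ • (pairField dWaveFormFactor L * ((fockD4 (L := L) γ).val * (fockTranslate v).val)) := by
  -- translations: `U_v Δ_d = Δ_d U_v`
  have hT : (fockTranslate v).val * pairField dWaveFormFactor L =
      pairField dWaveFormFactor L * (fockTranslate v).val :=
    (fockRelabel_commute_of_relabel_eq _ (relabel_translate_pairField dWaveFormFactor v)).eq
  -- point group: `U_γ Δ_d U_γᴴ = χ • Δ_d`, hence `U_γ Δ_d = (χ • Δ_d) U_γ`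
  have hD : (fockD4 (L := L) γ).val * pairField dWaveFormFactor L =
      (b1gChar γ • pairField dWaveFormFactor L) * (fockD4 (L := L) γ).val := by
    refine fockRelabel_mul_eq_of_conj_eq _ ?_
    rw [← relabel_eq_fockRelabel_conj]
    exact relabel_d4Perm_pairField_dWave γ
  rw [Matrix.mul_assoc, hT, ← Matrix.mul_assoc, hD, smul_mul_assoc, smul_mul_assoc, Matrix.mul_assoc]

/-- **The space-group unitary `U_γ U_v` preserves the Hermitian inner product.** [folklore] -/
theorem star_spaceGroup_mulVec_dotProduct (γ : DihedralGroup 4) (v : TorusSite 2 L)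
    (x y : Fock (Orb (FermionTorus 2 L))) :
    star (((fockD4 (L := L) γ).val * (fockTranslate v).val) *ᵥ x) ⬝ᵥ
        (((fockD4 (L := L) γ).val * (fockTranslate v).val) *ᵥ y) = star x ⬝ᵥ y := by
  -- each factor `U_π` is an isometry: `⟨U_π x, U_π y⟩ = star x ᵥ* (U_πᴴ U_π) ⬝ᵥ y = ⟨x, y⟩`
  -- (stated over a generic linearly ordered orbital type, so that only ONE `DecidableEq` instance is in play)
  have hiso : ∀ {ι : Type} [LinearOrder ι] [Fintype ι] (π : Equiv.Perm ι) (x y : Fock ι),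
      star ((fockRelabel π).val *ᵥ x) ⬝ᵥ ((fockRelabel π).val *ᵥ y) = star x ⬝ᵥ y := by
    intro ι _ _ π x y
    rw [star_mulVec, dotProduct_mulVec, vecMul_vecMul, fockRelabel_val, fockRelabel_conjTranspose_mul_self,
      vecMul_one]
  rw [← mulVec_mulVec, ← mulVec_mulVec, fockD4_apply, hiso, hiso]

/-- **The space group transports sector ground states of the Hubbard torus**: `U_γ U_v ψ` is a ground state of
`hubbardTorus 2 L t U` in `(N, S^z = M)` whenever `ψ` is. [folklore] -/
theorem IsGroundStateInSector.spaceGroup_mulVec (γ : DihedralGroup 4) (v : TorusSite 2 L) (t U : ℝ)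
    {N : ℕ} {M : ℝ} {ψ : Fock (Orb (FermionTorus 2 L))}
    (hψ : IsGroundStateInSector (hubbardTorus 2 L t U) N M ψ) :
    IsGroundStateInSector (hubbardTorus 2 L t U) N M (((fockD4 (L := L) γ).val * (fockTranslate v).val) *ᵥ ψ) := by
  rw [← mulVec_mulVec]
  exact (hψ.fockTranslate_mulVec v (relabel_translate_hubbardTorus v t U)).fockD4_mulVec γ
    (relabel_d4Perm_hubbardTorus γ t U)

/-- **THE SELECTION RULE FOR THE `d`-WAVE PAIR FIELD.** If `φ` and the UNIT vector `χ` are eigenvectors of the space-group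
unitary `U_g = U_γ U_v` with eigenvalues `lam`, `mu`, and `mu ≠ χ_{B₁g}(γ) · lam`, then `⟨χ, Δ_d φ⟩ = 0`: the `d_{x²-y²}`
pair amplitude between states of mismatched momentum (`γ = 1`) or mismatched `C₄` character (`v = 0`) vanishes
identically. [cite: Scalapino1995, §2 eq. (2.3)] -/
theorem pairField_dWave_matrixElement_eq_zero (γ : DihedralGroup 4) (v : TorusSite 2 L) (lam mu : ℂ)
    (φ χ : Fock (Orb (FermionTorus 2 L)))
    (hφ : ((fockD4 (L := L) γ).val * (fockTranslate v).val) *ᵥ φ = lam • φ)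
    (hχ : ((fockD4 (L := L) γ).val * (fockTranslate v).val) *ᵥ χ = mu • χ)
    (hχ1 : star χ ⬝ᵥ χ = 1) (hne : mu ≠ b1gChar γ * lam) :
    star χ ⬝ᵥ (pairField dWaveFormFactor L *ᵥ φ) = 0 := by
  have hV := star_spaceGroup_mulVec_dotProduct (L := L) γ v
  -- `|mu| = 1`, so `mu ≠ χ lam` is `star mu * χ * lam ≠ 1`
  have hmu : star mu * mu = 1 := star_mul_self_eq_one_of_eigen _ mu χ hV hχ hχ1
  have hne' : star mu * b1gChar γ * lam ≠ 1 := by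
    intro h1
    apply hne
    calc mu = mu * (star mu * b1gChar γ * lam) := by rw [h1, mul_one]
      _ = (star mu * mu) * (b1gChar γ * lam) := by ring
      _ = b1gChar γ * lam := by rw [hmu, one_mul]
  exact dotProduct_mulVec_eq_zero_of_twisted_eigen _ (pairField dWaveFormFactor L) (b1gChar γ) lam mu φ χ hV
    (spaceGroup_mul_pairField_dWave γ v) hφ hχ hne'

end Torus

end Literature.MathematicalPhysics.QuantumLattice

end
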